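import Mathlib
import HarnessLib
import Summits.NavierStokesRegularity.NavierStokesRegularity.Theses.RootDecompThresholdSaddle
import Literature.Analysis.FluidPDE.VectorCalculus
import Literature.Analysis.FluidPDE.KatoViscosityScaling
import Literature.Analysis.FluidPDE.KatoGlobalSmallHolds
import Literature.Analysis.FluidPDE.NSLerayHopfSereginProofs

/-!
# RootDecompThresholdSaddle — support LBE `LeanBadDatumExists` (stmt-NavierStokesRegularity-29109) PROVED

Route N7 `route-NavierStokesRegularity-RootDecompThresholdSaddle` (decomp-ns lens-4 g4 «threshold
saddle»; writer g3) — the item is shared verbatim by N10 RootDecompLeanestSingularity, N14/N15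
(SpikeAnatomy / TerminalTriage bookings) and N26 RootDecompFactorLadder (through the support conjunction
`ThresholdSaddleConeRest`, stmt-33312), and is a load-bearing binder of each of their `closes`. Its
docstring: «PROVED in the lens file (§4 `exists_nearMinimal_bad` + `NearMinimal.mono`, ≈ 90 lines over the
tree's `exists_kato_threshold` and `hasGlobalKatoSolution_smul_iff`; port = copy into Theorems/)». This file
is that port: §3–§4 of the lens file `LeanestSingularity.lean` (decomp-ns lens-4 g3, kernel-clean, critic
CLEARED) with the lens vocabulary `ClayDatum` / `NearMinimal` spelled out (no new definitions), concluded
against the route decl BY NAME.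

Content — LEAN BAD DATA EXIST AND STAY LEAN UP THE VISCOSITY RAY. If some Clay datum (smooth,
divergence free, rapidly decaying) is bad (no global Kato solution) at viscosity `ν > 0`, then for every
`ε > 0` there is a bad Clay datum `w` at `ν` whose critical norm `‖w‖_{L³}` is within the factor `1 + ε` of
the critical norm of EVERY bad Clay datum at EVERY viscosity `ν' ≥ ν`. No compactness, no closedness, no
limit object: the blow-up threshold `m_ν = inf{‖v‖₃ : v bad Clay datum at ν}` is `> 0` by Kato's small-data
theorem (`kato_global_small_holds`, Kato 1984 Thm 2) and `< ∞` (the given bad datum is in `L³`), so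
`m_ν < (1+ε) m_ν` and the infimum is approached INSIDE the class (the exact minimiser — Jia–Šverák 2013,
doi:10.1137/120880197 — exists only in `L³` and leaves the class); and leanness CLIMBS in viscosity: a bad
Clay datum `v` at `ν' ≥ ν` rescales to the bad Clay datum `(ν/ν') • v` at `ν`
(`hasGlobalKatoSolution_smul_iff`, the amplitude–viscosity scaling), whose critical norm is smaller by the
factor `ν/ν' ≤ 1`. Navier–Stokes regularity is NOT proved by anything here (rung 0): the lineage's
residuals NMT/PER/CompactLeanThresholdIsTypeI and the blocker 1217 stay open.

References: Kato1984 (tree `kato_global_small_holds`); LemarieRieusset2016 doi:10.1201/b19556 Prop 12.3;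
JiaSverak2013 doi:10.1137/120880197 (minimal `L³` blow-up data, cited for contrast only).
-/
noncomputable section

-- the summit and its single sub-problem share the name (CONVENTIONS §1), as in every Theorems file
set_option linter.dupNamespace false

open Literature.Analysis Literature.Analysis.FluidPDE MeasureTheory Set Function Filter Topology
open scoped ENNReal NNReal

namespace Summit.NavierStokesRegularity.NavierStokesRegularity.Theorems.LeanBadDatumExists

/-! ## Soft kernel facts: Clay data are Kato data; the Clay class is a cone -/

/-- A Clay datum (smooth, divergence free, rapidly decaying) lies in `L³`: it is bounded and in `L²`
(every `H^k`-seminorm is finite, `HasRapidSpatialDecay.lintegral_enorm_iteratedFDeriv_sq_lt_top`), and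
`‖u₀‖₃³ ≤ ‖u₀‖_∞ ‖u₀‖₂²` (`eLpNorm_three_pow_le`). (The `L³` block of the Kato → maximal bookkeeping of
the proved frame item 0055, verbatim.) -/
theorem memLp_three_of_clay {u₀ : EuclideanSpace ℝ (Fin 3) → EuclideanSpace ℝ (Fin 3)}
    (h : ContDiff ℝ (⊤ : ℕ∞) u₀ ∧ NSWave0.IsDivFree u₀ ∧ HasRapidSpatialDecay u₀) :
    MemLp u₀ 3 volume := by
  obtain ⟨hsm, -, hdec⟩ := h
  have hHk : ∀ n : ℕ, ∫⁻ x, ‖iteratedFDeriv ℝ n u₀ x‖ₑ ^ 2 < ⊤ :=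
    hdec.lintegral_enorm_iteratedFDeriv_sq_lt_top
  have hmeas0 : AEStronglyMeasurable u₀ volume := hsm.continuous.aestronglyMeasurable
  have hL2 : ∫⁻ x, ‖u₀ x‖ₑ ^ 2 < ⊤ := by
    refine lt_of_le_of_lt (le_of_eq (lintegral_congr fun x => ?_)) (hHk 0)
    rw [← ofReal_norm, ← ofReal_norm, norm_iteratedFDeriv_zero]
  have hu2 : MemLp u₀ 2 volume := ⟨hmeas0, eLpNorm_two_lt_top_of_lintegral_enorm_sq_lt_top hL2⟩
  obtain ⟨C₀, hC₀⟩ := hdec 0 0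
  have hbd0 : ∀ x, ‖u₀ x‖ ≤ C₀ := fun x => by
    have h := hC₀ x
    rwa [pow_zero, one_mul, norm_iteratedFDeriv_zero] at h
  refine ⟨hmeas0, ?_⟩
  have h3 : eLpNorm u₀ 3 volume ^ 3 ≤ eLpNorm u₀ ⊤ volume * eLpNorm u₀ 2 volume ^ 2 :=
    eLpNorm_three_pow_le hmeas0
  have htop : eLpNorm u₀ ⊤ volume ≤ ENNReal.ofReal C₀ := eLpNorm_top_le_of_bound hbd0
  have hfin : eLpNorm u₀ ⊤ volume * eLpNorm u₀ 2 volume ^ 2 < ⊤ :=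
    ENNReal.mul_lt_top (htop.trans_lt ENNReal.ofReal_lt_top)
      (ENNReal.pow_lt_top hu2.eLpNorm_lt_top)
  by_contra hnot
  rw [not_lt, top_le_iff] at hnot
  rw [hnot, ENNReal.top_pow (by norm_num)] at h3
  exact absurd (h3.trans_lt hfin) (lt_irrefl _)

/-- A Clay datum is weakly divergence free (`VectorCalculus.IsDivFree.isWeaklyDivFree_holds`). -/
theorem isWeaklyDivFree_of_clay {u₀ : EuclideanSpace ℝ (Fin 3) → EuclideanSpace ℝ (Fin 3)}
    (h : ContDiff ℝ (⊤ : ℕ∞) u₀ ∧ NSWave0.IsDivFree u₀ ∧ HasRapidSpatialDecay u₀) :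
    IsWeaklyDivFree u₀ :=
  VectorCalculus.IsDivFree.isWeaklyDivFree_holds (fun x => h.2.1 x)
    (h.1.of_le (by exact_mod_cast le_top))

/-- **Cone lemma**: Clay data are stable under scalar multiples (lens `clayDatum_smul`, verbatim). -/
theorem clay_smul {u₀ : EuclideanSpace ℝ (Fin 3) → EuclideanSpace ℝ (Fin 3)}
    (h : ContDiff ℝ (⊤ : ℕ∞) u₀ ∧ NSWave0.IsDivFree u₀ ∧ HasRapidSpatialDecay u₀) (a : ℝ) :
    ContDiff ℝ (⊤ : ℕ∞) (a • u₀) ∧ NSWave0.IsDivFree (a • u₀) ∧ HasRapidSpatialDecay (a • u₀) := by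
  obtain ⟨hs, hdiv, hdec⟩ := h
  refine ⟨hs.const_smul a, ?_, ?_⟩
  · intro x
    have hd : DifferentiableAt ℝ u₀ x := hs.contDiffAt.differentiableAt (by simp)
    have h1 : fderiv ℝ (a • u₀) x = a • fderiv ℝ u₀ x := fderiv_const_smul hd a
    have h0 := hdiv x
    unfold NSWave0.divergence at h0 ⊢
    rw [h1, ContinuousLinearMap.toLinearMap_smul, map_smul, h0, smul_zero]
  · intro n K
    obtain ⟨C, hC⟩ := hdec n K
    refine ⟨‖a‖ * C, fun x => ?_⟩
    have hn : ContDiffAt ℝ (n : ℕ∞) u₀ x := hs.contDiffAt.of_le (by exact_mod_cast le_top)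
    rw [iteratedFDeriv_const_smul_apply hn, norm_smul]
    calc (1 + ‖x‖) ^ K * (‖a‖ * ‖iteratedFDeriv ℝ n u₀ x‖)
        = ‖a‖ * ((1 + ‖x‖) ^ K * ‖iteratedFDeriv ℝ n u₀ x‖) := by ring
      _ ≤ ‖a‖ * C := mul_le_mul_of_nonneg_left (hC x) (norm_nonneg a)

/-- **Kato's small-data theorem for Clay data** (tree, PROVED: `kato_global_small_holds`, Kato 1984
Thm 2): with one absolute `δ > 0`, every Clay datum with `‖u₀‖₃ ≤ δν` is Kato-global at `ν` — the
blow-up threshold of the Clay class is `≥ δν > 0`. (Lens `exists_kato_threshold`, verbatim.) -/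
theorem exists_kato_threshold :
    ∃ δ : ℝ, 0 < δ ∧ ∀ ν : ℝ, 0 < ν →
      ∀ v : EuclideanSpace ℝ (Fin 3) → EuclideanSpace ℝ (Fin 3),
        (ContDiff ℝ (⊤ : ℕ∞) v ∧ NSWave0.IsDivFree v ∧ HasRapidSpatialDecay v) →
        eLpNorm v 3 volume ≤ ENNReal.ofReal (δ * ν) → HasGlobalKatoSolution ν v := by
  obtain ⟨δ, hδ, hkato⟩ := kato_global_small_holds
  refine ⟨δ, hδ, fun ν hν v hv hsmall => ?_⟩
  obtain ⟨u, hg, hcont, hu0, hm, -, -⟩ :=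
    hkato ν hν v (memLp_three_of_clay hv) (isWeaklyDivFree_of_clay hv) hsmall
  exact ⟨u, hg, hcont, hu0, hm⟩

/-! ## The extremal reduction: leanest bad data exist in the class and stay lean up the viscosity ray -/

/-- **EXTREMAL REDUCTION (kernel).** If some Clay datum is bad at viscosity `ν`, then for every
`ε > 0` there is a bad Clay datum which is `ε`-NEAR-MINIMAL among bad Clay data at `ν`: the threshold
`m_ν = inf{‖v‖₃ : v bad Clay datum at ν}` is `> 0` (`exists_kato_threshold`) and `< ∞` (the given bad
datum is in `L³`), so `m_ν < (1+ε) m_ν` and the infimum is approached INSIDE the class. (Lens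
`exists_nearMinimal_bad`, verbatim with the vocabulary spelled out.) -/
theorem exists_nearMinimal_bad {ε ν : ℝ} (hε : 0 < ε) (hν : 0 < ν)
    {u₀ : EuclideanSpace ℝ (Fin 3) → EuclideanSpace ℝ (Fin 3)}
    (hc : ContDiff ℝ (⊤ : ℕ∞) u₀ ∧ NSWave0.IsDivFree u₀ ∧ HasRapidSpatialDecay u₀)
    (hbad : ¬ HasGlobalKatoSolution ν u₀) :
    ∃ w : EuclideanSpace ℝ (Fin 3) → EuclideanSpace ℝ (Fin 3),
      (ContDiff ℝ (⊤ : ℕ∞) w ∧ NSWave0.IsDivFree w ∧ HasRapidSpatialDecay w) ∧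
      ¬ HasGlobalKatoSolution ν w ∧
      ∀ v : EuclideanSpace ℝ (Fin 3) → EuclideanSpace ℝ (Fin 3),
        (ContDiff ℝ (⊤ : ℕ∞) v ∧ NSWave0.IsDivFree v ∧ HasRapidSpatialDecay v) →
        ¬ HasGlobalKatoSolution ν v →
          eLpNorm w 3 volume ≤ ENNReal.ofReal (1 + ε) * eLpNorm v 3 volume := by
  classical
  set B : Set (EuclideanSpace ℝ (Fin 3) → EuclideanSpace ℝ (Fin 3)) :=
    {v | (ContDiff ℝ (⊤ : ℕ∞) v ∧ NSWave0.IsDivFree v ∧ HasRapidSpatialDecay v) ∧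
      ¬ HasGlobalKatoSolution ν v} with hB
  set m : ENNReal := sInf ((fun v => eLpNorm v 3 volume) '' B) with hm
  have hu₀B : u₀ ∈ B := ⟨hc, hbad⟩
  -- the threshold is positive: Kato's small-data theorem
  obtain ⟨δ, hδ, hkato⟩ := exists_kato_threshold
  have hδν : 0 < ENNReal.ofReal (δ * ν) := ENNReal.ofReal_pos.2 (mul_pos hδ hν)
  have hm_lower : ENNReal.ofReal (δ * ν) ≤ m := by
    refine le_sInf ?_
    rintro _ ⟨v, hvB, rfl⟩
    by_contra hlt
    exact hvB.2 (hkato ν hν v hvB.1 (le_of_lt (not_le.1 hlt)))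
  have hm0 : m ≠ 0 := (lt_of_lt_of_le hδν hm_lower).ne'
  -- the threshold is finite: the given bad datum is in `L³`
  have hm_le : m ≤ eLpNorm u₀ 3 volume := sInf_le ⟨u₀, hu₀B, rfl⟩
  have hm_top : m ≠ ⊤ := ne_top_of_le_ne_top (memLp_three_of_clay hc).eLpNorm_ne_top hm_le
  -- `m < (1 + ε) m`
  have hlt : m < ENNReal.ofReal (1 + ε) * m := by
    rw [ENNReal.ofReal_add zero_le_one hε.le, ENNReal.ofReal_one, add_mul, one_mul]
    exact ENNReal.lt_add_right hm_top (mul_ne_zero ((ENNReal.ofReal_pos.2 hε).ne') hm0)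
  -- pick a bad Clay datum below `(1 + ε) m`
  obtain ⟨_, ⟨w, hwB, rfl⟩, hw⟩ := sInf_lt_iff.1 hlt
  refine ⟨w, hwB.1, hwB.2, fun v hv hvbad => ?_⟩
  have hvB : v ∈ B := ⟨hv, hvbad⟩
  have hmv : m ≤ eLpNorm v 3 volume := sInf_le ⟨v, hvB, rfl⟩
  calc eLpNorm w 3 volume ≤ ENNReal.ofReal (1 + ε) * m := hw.le
    _ ≤ ENNReal.ofReal (1 + ε) * eLpNorm v 3 volume := by gcongr

/-- **LEANNESS CLIMBS IN VISCOSITY (kernel).** Near-minimality at `ν` implies near-minimality at every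
`ν' ≥ ν`: a bad Clay datum `v` at `ν'` rescales to the bad Clay datum `(ν/ν') • v` at `ν`
(`hasGlobalKatoSolution_smul_iff`, the amplitude–viscosity scaling), whose critical norm is SMALLER by
the factor `ν/ν' ≤ 1`. (Lens `NearMinimal.mono`, verbatim with the vocabulary spelled out.) -/
theorem nearMinimal_mono {ε ν ν' : ℝ} {u₀ : EuclideanSpace ℝ (Fin 3) → EuclideanSpace ℝ (Fin 3)}
    (h : ∀ v : EuclideanSpace ℝ (Fin 3) → EuclideanSpace ℝ (Fin 3),
      (ContDiff ℝ (⊤ : ℕ∞) v ∧ NSWave0.IsDivFree v ∧ HasRapidSpatialDecay v) →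
      ¬ HasGlobalKatoSolution ν v →
        eLpNorm u₀ 3 volume ≤ ENNReal.ofReal (1 + ε) * eLpNorm v 3 volume)
    (hν : 0 < ν) (hle : ν ≤ ν') :
    ∀ v : EuclideanSpace ℝ (Fin 3) → EuclideanSpace ℝ (Fin 3),
      (ContDiff ℝ (⊤ : ℕ∞) v ∧ NSWave0.IsDivFree v ∧ HasRapidSpatialDecay v) →
      ¬ HasGlobalKatoSolution ν' v →
        eLpNorm u₀ 3 volume ≤ ENNReal.ofReal (1 + ε) * eLpNorm v 3 volume := by
  intro v hv hvbad
  have hν' : 0 < ν' := lt_of_lt_of_le hν hle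
  have ha : 0 < ν / ν' := div_pos hν hν'
  have ha1 : ν / ν' ≤ 1 := (div_le_one hν').2 hle
  have hbad : ¬ HasGlobalKatoSolution ν ((ν / ν') • v) := by
    intro hK
    have hK' : HasGlobalKatoSolution (ν / ν' * ν') ((ν / ν') • v) := by
      rwa [div_mul_cancel₀ ν hν'.ne']
    exact hvbad ((hasGlobalKatoSolution_smul_iff ha).1 hK')
  have h1 := h ((ν / ν') • v) (clay_smul hv _) hbad
  rw [eLpNorm_const_smul, Real.enorm_eq_ofReal ha.le] at h1
  have ha1' : ENNReal.ofReal (ν / ν') ≤ 1 := ENNReal.ofReal_le_one.2 ha1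
  calc eLpNorm u₀ 3 volume
      ≤ ENNReal.ofReal (1 + ε) * (ENNReal.ofReal (ν / ν') * eLpNorm v 3 volume) := h1
    _ ≤ ENNReal.ofReal (1 + ε) * (1 * eLpNorm v 3 volume) := by gcongr
    _ = ENNReal.ofReal (1 + ε) * eLpNorm v 3 volume := by rw [one_mul]

/-- **Support LBE `LeanBadDatumExists` (stmt-NavierStokesRegularity-29109) holds**: the route decl
`Theses.RootDecompThresholdSaddle.LeanBadDatumExists` — `exists_nearMinimal_bad` at `ν`, then
`nearMinimal_mono` up the viscosity ray `ν' ≥ ν`. -/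
theorem leanBadDatumExists_proof : Theses.RootDecompThresholdSaddle.LeanBadDatumExists := by
  intro ε hε ν hν u₀ hc hbad
  obtain ⟨w, hw, hwbad, hmin⟩ := exists_nearMinimal_bad hε hν hc hbad
  exact ⟨w, hw, hwbad, fun ν' hle v hv hvbad => nearMinimal_mono hmin hν hle v hv hvbad⟩

end Summit.NavierStokesRegularity.NavierStokesRegularity.Theorems.LeanBadDatumExists

end
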